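import Literature.MathematicalPhysics.QuantumFieldTheory.Balaban1983to89.B1Eq324BenfattoKernelSect5ChiToOneOnData
import Literature.MathematicalPhysics.QuantumFieldTheory.Balaban1983to89.B1Eq324BenfattoSect5PerBoxOnData
import HarnessLib

/-!
# `Balaban1983to89.B1Eq324BenfattoKernelSect5PerBoxOnData` — [BenfattoEtAl1978] §5 pp. 157–159: THE PER-BOX RELATION (5.30)→(5.33)/(5.36)
# ON PRINT'S OBJECTS FOR A SHIFTED GAUSSIAN KERNEL FIELD `𝒩(0,K)∘(u + ·)⁻¹` — the box small-field event `χ_b^□`, the pieces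
# `Ψ′₁, Ψ″₁, Ψ₂, Ψ₃` of the boxes line — with the volume input (5.19), the a-priori sizes (5.15) i)/(5.24) and the χ-removal (5.29)₁
# DISCHARGED from DISPLAYED rows on `(K, u)`; the two Appendix-D cluster inputs displayed per colouring against an ARBITRARY
# reference measure `ν` (print's `P̂₀`; the class road's `𝒩(0, K_Λ)`)

statement-level skeleton of published theorems with citation tags; proofs where landed; nothing here is a claim about the
Yang–Mills mass gap

WHY THIS MODULE (cell `pub-ymgap`, seat `dag-n08-c` gen 31; node N08 [Balaban1985UV3]; the [BenfattoEtAl1978] source chain behind the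
(α)-row `h324`; ROW 8 of the seat's cluster-side port map `N08-PORT-MAP-CLUSTER-SIDE.md` §1).  n08-b's `…Sect5PerBoxOnData.perBox_condField`
instantiates the abstract per-box relation `…Sect5PerBox.abs_log_integral_perBox_le_of_colourings` on print's objects for the conditioned FREE
field `P̄ = condField d α β Γ ξ`, discharging (5.19) (App. C Lemma 2), the local sizes (5.15) i)/(5.24), the χ-removal (5.29)₁ and «`z = ξ` on `Γ`
a.s.» from free-field facts.  On the class road the per-box measure of the pavement step is a PART FIELD
`N^K_{□,ξ} = (gaussianFieldOfKernel K_□).map (fun ζ x => condMean K Γ₁ ξ x + ζ x)` (`…KernelSect5PavementStep.pavementStep_of_setIntegral`, seat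
n08-d g13, hypothesis `hbox`), i.e. a shifted Gaussian kernel field; this file is the SAME instantiation for the shifted field
`μ_{K,u} = (gaussianFieldOfKernel K).map (u + ·)` of a GENERIC kernel `K` and centre `u` on the lattice, with every free-field fact replaced by
a DISPLAYED ROW: R1 `K(y,y) ≤ c₀` (moments), R3 `|u(y)| ≤ Kᵤ` on `I` (the (C.8) constant), the Lemma-2 rows on `□′∪Γ₂(□)` — R1′ `K(x,x) ≤ ½`,
R3′ `|u(x)| ≤ ½b(1+d(Δ_x,I))` — and the conditioning row R6 `z = ξ on Γ, μ_{K,u}-a.s.` (at the part field: `…KernelSect5Eq513.partField_ae_eqOn`;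
for the free field: `…Sect5Eq515.condField_ae_eqOn`).  The (5.31) reference cumulants are taken against an ARBITRARY measure `ν` on
configurations (print: `P̂₀ = P0 d α β`; class road: `gaussianFieldOfKernel K_Λ`, n08-b `N08-CLASS-TOOLKIT.md` §6), so the module is `K_ref`-agnostic.
Inputs BY NAME: the measure-free §1/§2 of the concrete module (`psi1p/psi1pp/psi2_eq_tupleSum`, `abs_psi1p/psi1/psi1pp/psi2/psi3_le_box`),
`…Sect5Eq515.abs_psiBox_le_local`, row 6 `…KernelSect5ChiToOneOnData.abs_ursellOf_tupleSum_mul_sub_shift_le_of_rows`, (5.19) for the shifted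
field from `…KernelAppendixCLemma2.appC_lemma2_of_shift` + `…Sect5Cumulant.exp_neg_three_mul_le`, and n08-b's abstract
`…Sect5PerBox.abs_log_integral_perBox_le_of_colourings` / `integral_mul_exp_mul_eq_of_indicator`.

DICTIONARY.  As in `…Sect5PerBoxOnData` with `P̄ ↦ μ_{K,u} = (gaussianFieldOfKernel K).map fun ζ y => u y + ζ y` (VERBATIM), `P̂₀ ↦ ν`;
`K = 4s₁Ab^DL^d`, `ε = s₁Ab^De^{−(ϰ/4)v}L^d`, `W = 3|□′∪Γ₂(□)|e^{−b²/4}`, `c_k` = the constant of row 6 at `k` slots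
(`(1+Kᵤ)^D·M·momentConst D (2k) c₀`).  The concrete module is the instance `K := condCov (freeCov d α β) Γ`, `u := condMean (freeCov d α β) Γ ξ`,
`ν := P0 d α β`, `Kᵤ := (1+2d/α²)γb`, `c₀ := (freeCov d α β 0 0)⁺`.

WHAT IS PROVED (theorems only; no definition, no named fact, no `sorry`; axioms standard).
* ★★ **`perBox_shift`** — THE PER-BOX RELATION ON PRINT'S OBJECTS UNDER `μ_{K,u}` as a package: for `lhs = ∫_S e^{Ψ_□} dμ_{K,u}`,
  `rhs = ∫_S e^{Ψ′₁+Ψ₂} dμ_{K,u}`, `E = Σ_{k≤t}(Σ_{f uses Ψ″₁, avoids Ψ₂} 𝓔^T_ν(f))/k!` and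
  `Err = 2·2^{C(t+1,2)}K^{t+1}/(t+1)! + e^{2K}W + Σ_{k≤t}(3^k s_k εK^{k−1} + 3^k(c_k + δ₂₉(k)) + 3^k(c_k + δ₃₁(k)))/k!`:
  `0 < lhs`, `0 < rhs`, `|log lhs − log rhs − E| ≤ Err`, `e^{E−Err}·rhs ≤ lhs`, `lhs ≤ e^{E+Err}·rhs` — the shape n08-d's `hbox` consumes with
  `ℓ_□ := E − Err`.

HONEST SCOPE / NOT HERE.  The rows and the two Appendix-D inputs `δ₂₉`, `δ₃₁` (currency of `…KernelSect5TupleClusters`, rows 3–5 of the port map)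
are DISPLAYED; their discharge at the class's per-box instance is the port map's row 10 (`…KernelSect5PerBoxAtPavement`), not here; constants AS
PROVED in the concrete module; one self-located row of an UNCOMMISSIONED port (plan g81 (II), START-LIST v11 §n08) — nothing chained; no
generalised Basic Lemma is stated; nothing of [Balaban1985UV3] is asserted; count-neutral for N08; nothing about d = 4, the continuum, OS
axioms, a mass gap or the Clay problem.
-/

open MeasureTheory ProbabilityTheory Finset
open scoped BigOperators Nat NNReal

namespace Literature.MathematicalPhysics.QuantumFieldTheory.Balaban1983to89.B1Eq324BenfattoKernelSect5PerBoxOnData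

open _root_.MeasureTheory _root_.ProbabilityTheory
open Literature.Probability.LatticeModels (setPartitions ursellOf)
open Literature.MathematicalPhysics.QuantumFieldTheory
open Literature.MathematicalPhysics.QuantumFieldTheory.Balaban1983to89.B1Eq324BenfattoLemma
open Literature.MathematicalPhysics.QuantumFieldTheory.Balaban1983to89.B1Eq324BenfattoSect5Boxes
open Literature.MathematicalPhysics.QuantumFieldTheory.Balaban1983to89.B1Eq324BenfattoSect5Eq511
open Literature.MathematicalPhysics.QuantumFieldTheory.Balaban1983to89.B1Eq324BenfattoSect5Eq524
open Literature.MathematicalPhysics.QuantumFieldTheory.Balaban1983to89.B1Eq324BenfattoSect5Eq534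
open Literature.MathematicalPhysics.QuantumFieldTheory.Balaban1983to89.B1Eq324BenfattoSect5Eq515
open Literature.MathematicalPhysics.QuantumFieldTheory.Balaban1983to89.B1Eq324BenfattoSect5Cumulant (exp_neg_three_mul_le)
open Literature.MathematicalPhysics.QuantumFieldTheory.Balaban1983to89.B1Eq324BenfattoKernelAppendixCLemma2 (appC_lemma2_of_shift)
open Literature.MathematicalPhysics.QuantumFieldTheory.Balaban1983to89.B1Eq324BenfattoSect5PerBoxOnData
  (psi1p_eq_tupleSum psi1pp_eq_tupleSum psi2_eq_tupleSum abs_psi1p_le_box abs_psi1_le_box abs_psi1pp_le_box abs_psi2_le_box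
   abs_psi3_le_box)
open Literature.MathematicalPhysics.QuantumFieldTheory.Balaban1983to89.B1Eq324BenfattoKernelSect5ChiToOneOnData
  (abs_ursellOf_tupleSum_mul_sub_shift_le_of_rows)
open Literature.MathematicalPhysics.QuantumFieldTheory.Balaban1983to89.B1Eq324GaussianMomentLeaf (momentConst one_le_momentConst)

variable {d : ℕ} {K : B1Eq324BenfattoLemma.Site d → B1Eq324BenfattoLemma.Site d → ℝ}

section OnData

variable {s D : ℕ} {κ : ℝ} {a : Coef d} {J I : Finset (B1Eq324BenfattoLemma.Site d)} {L w v : ℕ}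
  {m : B1Eq324BenfattoLemma.Site d} {Γ : Finset (B1Eq324BenfattoLemma.Site d)} {ξ : B1Eq324BenfattoLemma.Site d → ℝ}
  {γ b A M : ℝ}

/-- A tuple-class sum is measurable (a finite sum of monomials times constants). [folklore] -/
private theorem measurable_tupleSum (T : (p : ℕ) → Finset (Fin p → J)) :
    Measurable fun z : B1Eq324BenfattoLemma.Site d → ℝ =>
      ∑ p ∈ Finset.Icc 1 s, ∑ Δ ∈ T p, ∑ n ∈ admissible p D, term κ a z p Δ n := by
  refine Finset.measurable_sum _ fun p _ => Finset.measurable_sum _ fun Δ _ => Finset.measurable_sum _ fun n _ => ?_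
  unfold term
  exact measurable_const.mul (Finset.measurable_prod _ fun i _ => (measurable_pi_apply _).pow_const _)

/-- `Ψ₃` is measurable. [folklore] -/
private theorem measurable_psi3 : Measurable fun z : B1Eq324BenfattoLemma.Site d → ℝ => psi3 s D κ a L w v m z := by
  have h1 : Measurable fun z : B1Eq324BenfattoLemma.Site d → ℝ => psi1 s D κ a L w v m z := by
    unfold psi1 interaction
    exact ((measurable_hamiltonian _).add
      (((measurable_hamiltonian _).sub (measurable_hamiltonian _)).sub (measurable_hamiltonian _)))
  have h2 : Measurable fun z : B1Eq324BenfattoLemma.Site d → ℝ => psi2 s D κ a L w m z := by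
    unfold psi2 interaction
    exact ((((measurable_hamiltonian _).sub (measurable_hamiltonian _)).sub (measurable_hamiltonian _)).add
      (measurable_hamiltonian _))
  unfold psi3
  exact ((measurable_psiBox L w m).sub h1).sub h2

/-- Positivity of a cut exponential moment: `0 < ∫ χe^{X} dμ` when `∫χ ≥ e^{−W}` and `|X| ≤ K` a.e. [folklore] -/
private theorem integral_mul_exp_pos {Ω : Type*} {mΩ : MeasurableSpace Ω} {μ : Measure Ω} [IsProbabilityMeasure μ]
    {χ X : Ω → ℝ} {K W : ℝ} (hχm : Measurable χ) (hχ0 : ∀ ω, 0 ≤ χ ω) (hχ1 : ∀ ω, χ ω ≤ 1)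
    (hXm : AEMeasurable X μ) (hXK : ∀ᵐ ω ∂μ, |X ω| ≤ K) (hW : Real.exp (-W) ≤ ∫ ω, χ ω ∂μ) :
    0 < ∫ ω, χ ω * Real.exp (X ω) ∂μ := by
  have hχInt : Integrable χ μ :=
    Integrable.mono' (integrable_const (1 : ℝ)) hχm.aestronglyMeasurable (ae_of_all _ fun ω => by
      rw [Real.norm_eq_abs, abs_of_nonneg (hχ0 ω)]
      exact hχ1 ω)
  have heInt : Integrable (fun ω => Real.exp (X ω)) μ :=
    Integrable.mono' (integrable_const (Real.exp K))
      (Real.measurable_exp.comp_aemeasurable hXm).aestronglyMeasurable (hXK.mono fun ω hω => by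
        rw [Real.norm_eq_abs, abs_of_pos (Real.exp_pos _)]
        exact Real.exp_le_exp.2 (abs_le.1 hω).2)
  have hχeInt : Integrable (fun ω => χ ω * Real.exp (X ω)) μ :=
    Integrable.mono' heInt (hχm.aestronglyMeasurable.mul
      (Real.measurable_exp.comp_aemeasurable hXm).aestronglyMeasurable) (ae_of_all _ fun ω => by
      rw [Real.norm_eq_abs, abs_mul, abs_of_nonneg (hχ0 ω), abs_of_pos (Real.exp_pos _)]
      exact mul_le_of_le_one_left (Real.exp_pos _).le (hχ1 ω))
  have hlow : Real.exp (-K) * ∫ ω, χ ω ∂μ ≤ ∫ ω, χ ω * Real.exp (X ω) ∂μ := by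
    rw [← integral_const_mul]
    refine integral_mono_ae (hχInt.const_mul _) hχeInt (hXK.mono fun ω hω => ?_)
    have h1 : Real.exp (-K) ≤ Real.exp (X ω) := Real.exp_le_exp.2 (abs_le.1 hω).1
    have h2 := hχ0 ω
    nlinarith
  exact lt_of_lt_of_le (mul_pos (Real.exp_pos _) ((Real.exp_pos _).trans_le hW)) hlow

/-- **THE PER-BOX RELATION (5.30)→(5.33) / (5.36) ON PRINT'S OBJECTS, SHIFTED KERNEL FIELD.**  Setting: a tessera `□ = □_m` of side `L` with
corridors of width `w` and inner corridors of width `v ≤ w`; the shifted Gaussian field `μ_{K,u} = 𝒩(0,K)∘(u + ·)⁻¹` of a positive-semidefinite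
kernel `K` on the lattice and a centre `u` with the DISPLAYED ROWS R1 `K(y,y) ≤ c₀`, R3 `|u(y)| ≤ Kᵤ` on `I` (`Kᵤ ≥ 0`), the Lemma-2 rows on
`□′∪Γ₂(□)` — `K(x,x) ≤ ½`, `|u(x)| ≤ ½b(1+d(Δ_x, I))` — and the conditioning row «`z = ξ` on `Γ ⊇ Γ₁(□)`, `μ_{K,u}`-a.s.» for SMALL-FIELD DATA
`|ξ_c| ≤ γb(1 + d(Δ_c, I))` (`γ ≤ 1`); the box small-field event `S = {|z_Δ| ≤ b(1+d(Δ,I)), Δ ⊂ □′∪Γ₂(□)}` (print's `χ_b^□`, (5.14)); the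
pieces `Ψ′₁, Ψ″₁, Ψ₂` as the tuple-class sums `T 0, T 1, T 2` with decay-weighted coefficient masses `≤ M`, `Ψ₃ = H′^{(l)}`; coefficients
`|A| ≤ A` under the extension convention on `J ⊆ I`; `b ≥ 1`, `|□′∪Γ₂(□)|e^{−b²/4} ≤ 1/6`; an arbitrary REFERENCE measure `ν` for the (5.31)
cumulants.  DISPLAYED INPUTS, per colouring `f` of `k ≤ t` slots: (5.29)₂ `|𝓔^T_{μ_{K,u}}(uncut slots of f)| ≤ δ₂₉(k)` for `f` using `Ψ″₁` and `Ψ₂`,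
and the (5.31) «(error)» `|𝓔^T_{μ_{K,u}}(uncut f) − 𝓔^T_ν(uncut f)| ≤ δ₃₁(k)` for `f` using `Ψ″₁` and avoiding `Ψ₂`.  CONCLUSION (a package,
`lhs = ∫_S e^{Ψ_□} dμ_{K,u}`, `rhs = ∫_S e^{Ψ′₁+Ψ₂} dμ_{K,u}`, `E = Σ_{k≤t} (Σ_{f uses Ψ″₁, avoids Ψ₂} 𝓔^T_ν(f))/k!`): `0 < lhs`, `0 < rhs`,
`|log lhs − log rhs − E| ≤ Err`, and `e^{E−Err}·rhs ≤ lhs ≤ e^{E+Err}·rhs`, with `Err = 2·2^{C(t+1,2)}K^{t+1}/(t+1)! + e^{2K}·3|□′∪Γ₂(□)|e^{−b²/4} +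
Σ_{k≤t}(3^k s_k εK^{k−1} + 3^k(c_k + δ₂₉(k)) + 3^k(c_k + δ₃₁(k)))/k!`, `K = 4s₁Ab^DL^d`, `ε = s₁Ab^De^{−(ϰ/4)v}L^d` and
`c_k = 2^k(Σ_π(|π|−1)!)(min 1 (2|□′∪Γ₂|e^{−b²/4}))^{1/(2k)}((1+Kᵤ)^D·M·momentConst D (2k) c₀)^k`.  The concrete `…Sect5PerBoxOnData.perBox_condField` is the
instance `K := condCov (freeCov …) Γ`, `u := condMean … ξ`, `ν := P0 d α β`. [cite: BenfattoEtAl1978, (5.30)–(5.33) pp.158–159, (5.36) p.159] -/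
theorem perBox_shift (hK : IsPosSemidefKernel K) (u : B1Eq324BenfattoLemma.Site d → ℝ) {c₀ : ℝ≥0} (hdiag : ∀ y, K y y ≤ c₀)
    (ν : Measure (B1Eq324BenfattoLemma.Site d → ℝ))
    (hκ : 0 < κ) (hJ : CoefSupportedIn a J) (hJI : J ⊆ I) (hA0 : 0 ≤ A)
    (hA : ∀ (p : ℕ) (Δ : Fin p → B1Eq324BenfattoLemma.Site d) (n : Fin p → ℕ), |a p Δ n| ≤ A)
    (hv : v ≤ w) (hb : 1 ≤ b) (hγ1 : γ ≤ 1)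
    {Ku : ℝ} (hKu : 0 ≤ Ku) (hu : ∀ y ∈ I, |u y| ≤ Ku)
    (hvar : ∀ x ∈ shrink L m w, K x x ≤ 1 / 2) (hm : ∀ x ∈ shrink L m w, |u x| ≤ 1 / 2 * b * (1 + distToRegion I x))
    (hΓ : frame1 L w m ⊆ Γ) (hξ : ∀ c ∈ Γ, |ξ c| ≤ γ * b * (1 + distToRegion I c))
    (hae : ∀ᵐ z ∂((gaussianFieldOfKernel K).map
        fun (ζ : B1Eq324BenfattoLemma.Site d → ℝ) (y : B1Eq324BenfattoLemma.Site d) => u y + ζ y), ∀ c ∈ Γ, z c = ξ c)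
    (hsmall : ((shrink L m w).card : ℝ) * Real.exp (-(b ^ 2 / 4)) ≤ 1 / 6)
    (T : Fin 3 → (p : ℕ) → Finset (Fin p → J))
    (hT0 : ∀ p, T 0 p = tuplesIn J p (frame4 L w v m) ∪ crossT J p (frame4 L w v m) (frame3 L w v m))
    (hT1 : ∀ p, T 1 p = (tuplesIn J p (core L w m) \ tuplesIn J p (frame4 L w v m)) ∪
      (crossT J p (core L w m) (frame3 L w v m) \ crossT J p (frame4 L w v m) (frame3 L w v m)))
    (hT2 : ∀ p, T 2 p = crossT J p (frame1 L w m) (frame2 L w m) ∪ tuplesIn J p (frame2 L w m))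
    (hM : ∀ c, ∑ p ∈ Finset.Icc 1 s, ∑ Δ ∈ T c p, ∑ n ∈ admissible p D,
      |a p (fun i => (Δ i : B1Eq324BenfattoLemma.Site d)) n| *
        Real.exp (-(κ / 2) * connLength fun i => (Δ i : B1Eq324BenfattoLemma.Site d)) ≤ M)
    {t : ℕ} {δ₂₉ δ₃₁ : ℕ → ℝ} (hδ₂₉ : ∀ k, 0 ≤ δ₂₉ k) (hδ₃₁ : ∀ k, 0 ≤ δ₃₁ k)
    (h29 : ∀ k < t, ∀ f : Fin (k + 1) → Fin 3, (∃ j, f j = 1) → (∃ j, f j = 2) →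
      |ursellOf (fun P : Finset (Fin (k + 1)) => ∫ z, ∏ j ∈ P,
          (∑ p ∈ Finset.Icc 1 s, ∑ Δ ∈ T (f j) p, ∑ n ∈ admissible p D, term κ a z p Δ n)
            ∂((gaussianFieldOfKernel K).map
              fun (ζ : B1Eq324BenfattoLemma.Site d → ℝ) (y : B1Eq324BenfattoLemma.Site d) => u y + ζ y)) univ|
        ≤ δ₂₉ (k + 1))
    (h31 : ∀ k < t, ∀ f : Fin (k + 1) → Fin 3, (∃ j, f j = 1) → (∀ j, f j ≠ 2) →
      |ursellOf (fun P : Finset (Fin (k + 1)) => ∫ z, ∏ j ∈ P,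
            (∑ p ∈ Finset.Icc 1 s, ∑ Δ ∈ T (f j) p, ∑ n ∈ admissible p D, term κ a z p Δ n)
              ∂((gaussianFieldOfKernel K).map
                fun (ζ : B1Eq324BenfattoLemma.Site d → ℝ) (y : B1Eq324BenfattoLemma.Site d) => u y + ζ y)) univ -
        ursellOf (fun P : Finset (Fin (k + 1)) => ∫ z, ∏ j ∈ P,
            (∑ p ∈ Finset.Icc 1 s, ∑ Δ ∈ T (f j) p, ∑ n ∈ admissible p D, term κ a z p Δ n) ∂ν) univ|
        ≤ δ₃₁ (k + 1)) :
    let Kc : ℝ := 4 * (s1Const s D d κ * A * b ^ D * (L : ℝ) ^ d)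
    let ε : ℝ := s1Const s D d κ * A * b ^ D * Real.exp (-(κ / 4 * v)) * (L : ℝ) ^ d
    let W : ℝ := 3 * (((shrink L m w).card : ℝ) * Real.exp (-(b ^ 2 / 4)))
    let cχ : ℕ → ℝ := fun k => 2 ^ k * ((∑ π ∈ setPartitions (univ : Finset (Fin k)), ((π.card - 1)! : ℝ)) *
        ((min 1 (2 * ((shrink L m w).card : ℝ) * Real.exp (-(b ^ 2 / 4)))) ^ ((2 * k : ℕ) : ℝ)⁻¹ *
          ((1 + Ku) ^ D * M * momentConst D (2 * k) c₀) ^ k))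
    let lhs : ℝ := ∫ z in smallFieldOn (shrink L m w : Set (B1Eq324BenfattoLemma.Site d)) I b,
          Real.exp (psiBox s D κ a L w m z) ∂((gaussianFieldOfKernel K).map
            fun (ζ : B1Eq324BenfattoLemma.Site d → ℝ) (y : B1Eq324BenfattoLemma.Site d) => u y + ζ y)
    let rhs : ℝ := ∫ z in smallFieldOn (shrink L m w : Set (B1Eq324BenfattoLemma.Site d)) I b,
          Real.exp (psi1p s D κ a L w v m z + psi2 s D κ a L w m z) ∂((gaussianFieldOfKernel K).map
            fun (ζ : B1Eq324BenfattoLemma.Site d → ℝ) (y : B1Eq324BenfattoLemma.Site d) => u y + ζ y)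
    let E : ℝ := ∑ k ∈ Finset.range t,
            (∑ f ∈ univ.filter (fun f : Fin (k + 1) → Fin 3 => (∃ j, f j = 1) ∧ ∀ j, f j ≠ 2),
              ursellOf (fun P : Finset (Fin (k + 1)) => ∫ z, ∏ j ∈ P,
                (∑ p ∈ Finset.Icc 1 s, ∑ Δ ∈ T (f j) p, ∑ n ∈ admissible p D, term κ a z p Δ n) ∂ν) univ)
              / (k + 1)!
    let Err : ℝ := 2 * (2 ^ ((t + 1).choose 2) * Kc ^ (t + 1) / (t + 1)!) + Real.exp (2 * Kc) * W
        + ∑ k ∈ Finset.range t,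
            (3 ^ (k + 1) * ((∑ π ∈ setPartitions (univ : Finset (Fin (k + 1))), ((π.card - 1)! : ℝ)) * (ε * Kc ^ k))
              + 3 ^ (k + 1) * (cχ (k + 1) + δ₂₉ (k + 1)) + 3 ^ (k + 1) * (cχ (k + 1) + δ₃₁ (k + 1))) / (k + 1)!
    0 < lhs ∧ 0 < rhs ∧ |Real.log lhs - Real.log rhs - E| ≤ Err ∧
      Real.exp (E - Err) * rhs ≤ lhs ∧ lhs ≤ Real.exp (E + Err) * rhs := by
  intro Kc ε W cχ lhs rhs E Err
  haveI := isProbabilityMeasure_gaussianFieldOfKernel hK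
  have hTm : Measurable (fun (ζ : B1Eq324BenfattoLemma.Site d → ℝ) (y : B1Eq324BenfattoLemma.Site d) => u y + ζ y) :=
    measurable_pi_lambda _ fun y => measurable_const.add (measurable_pi_apply y)
  haveI : IsProbabilityMeasure ((gaussianFieldOfKernel K).map
      fun (ζ : B1Eq324BenfattoLemma.Site d → ℝ) (y : B1Eq324BenfattoLemma.Site d) => u y + ζ y) :=
    Measure.isProbabilityMeasure_map hTm.aemeasurable
  -- abbreviations
  set P := (gaussianFieldOfKernel K).map
    fun (ζ : B1Eq324BenfattoLemma.Site d → ℝ) (y : B1Eq324BenfattoLemma.Site d) => u y + ζ y with hP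
  set S : Set (B1Eq324BenfattoLemma.Site d → ℝ) := smallFieldOn (shrink L m w : Set (B1Eq324BenfattoLemma.Site d)) I b
    with hS
  set Y : Fin 3 → (B1Eq324BenfattoLemma.Site d → ℝ) → ℝ :=
    fun c z => ∑ p ∈ Finset.Icc 1 s, ∑ Δ ∈ T c p, ∑ n ∈ admissible p D, term κ a z p Δ n with hY
  set χ : (B1Eq324BenfattoLemma.Site d → ℝ) → ℝ := S.indicator 1 with hχ
  set K₀ : ℝ := s1Const s D d κ * A * b ^ D * (L : ℝ) ^ d with hK₀
  have hK₀0 : 0 ≤ K₀ := by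
    have := s1Const_nonneg hκ s D d
    positivity
  have hKdef : Kc = 4 * K₀ := rfl
  have hb0 : 0 < b := lt_of_lt_of_le one_pos hb
  have hA' : ∀ p ∈ Finset.Icc 1 s, ∀ (Δ : Fin p → B1Eq324BenfattoLemma.Site d), (∀ i, Δ i ∈ J) →
      ∀ n ∈ admissible p D, |a p Δ n| ≤ A := fun p _ Δ _ n _ => hA p Δ n
  -- the event, the weight
  have hSm : MeasurableSet S := measurableSet_smallFieldOn _ I b
  have hχm : Measurable χ := measurable_one.indicator hSm
  have hχ0 : ∀ z, 0 ≤ χ z := fun z => Set.indicator_nonneg (fun _ _ => zero_le_one) z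
  have hχ1 : ∀ z, χ z ≤ 1 := fun z => Set.indicator_le_self' (fun _ _ => zero_le_one) z
  have hχ01 : ∀ z, χ z = 0 ∨ χ z = 1 := fun z => by
    by_cases h : z ∈ S
    · exact Or.inr (by simp [hχ, h])
    · exact Or.inl (by simp [hχ, h])
  have hχE : ∀ z : B1Eq324BenfattoLemma.Site d → ℝ,
      (∀ x ∈ shrink L m w, |z x| < b * (1 + distToRegion I x)) → χ z = 1 := by
    intro z hz
    have hzS : z ∈ S := fun x hx => (hz x (Finset.mem_coe.1 hx)).le
    simp [hχ, hzS]
  -- the pieces: identification with print's `Ψ′₁, Ψ″₁, Ψ₂`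
  have hY0 : ∀ z, Y 0 z = psi1p s D κ a L w v m z := fun z => by
    simp only [hY, hT0]; exact (psi1p_eq_tupleSum hJ z).symm
  have hY1 : ∀ z, Y 1 z = psi1pp s D κ a L w v m z := fun z => by
    simp only [hY, hT1]; exact (psi1pp_eq_tupleSum hJ z).symm
  have hY2 : ∀ z, Y 2 z = psi2 s D κ a L w m z := fun z => by
    simp only [hY, hT2]; exact (psi2_eq_tupleSum hJ z).symm
  have hsumΨ : ∀ z, Y 0 z + Y 1 z + Y 2 z + psi3 s D κ a L w v m z = psiBox s D κ a L w m z := fun z => by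
    rw [hY0, hY1, hY2, psi1pp, psi3, psi1]
    ring
  have hsum02 : ∀ z, Y 0 z + Y 2 z = psi1p s D κ a L w v m z + psi2 s D κ a L w m z := fun z => by rw [hY0, hY2]
  -- measurability
  have hYm : ∀ c, AEStronglyMeasurable (Y c) P := fun c => (measurable_tupleSum (T c)).aestronglyMeasurable
  have hDm : AEStronglyMeasurable (fun z => psi3 s D κ a L w v m z) P := measurable_psi3.aestronglyMeasurable
  -- a.s. on `Γ` the field IS the datum (row R6); on `S` the box coordinates of `J` are `≤ b`
  have hzb : ∀ᵐ z ∂P, z ∈ S → ∀ x ∈ J, x ∈ box L m → |z x| ≤ b := by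
    refine hae.mono fun z hz hzS x hxJ hxb => ?_
    by_cases hxs : x ∈ shrink L m w
    · have h := hzS x (Finset.mem_coe.2 hxs)
      rwa [Literature.MathematicalPhysics.QuantumFieldTheory.Balaban1983to89.B1Eq324BenfattoSect5SlotMoments.distToRegion_eq_zero_of_mem
        (hJI hxJ), add_zero, mul_one] at h
    · have hxf : x ∈ frame1 L w m := by
        rw [frame1]
        exact Finset.mem_sdiff.2 ⟨hxb, hxs⟩
      rw [hz x (hΓ hxf)]
      have h := hξ x (hΓ hxf)
      rw [Literature.MathematicalPhysics.QuantumFieldTheory.Balaban1983to89.B1Eq324BenfattoSect5SlotMoments.distToRegion_eq_zero_of_mem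
        (hJI hxJ), add_zero, mul_one] at h
      exact h.trans (by nlinarith)
  -- the a.e. bounds of the cut slots
  have cut : ∀ {X : (B1Eq324BenfattoLemma.Site d → ℝ) → ℝ} {B : ℝ}, 0 ≤ B →
      (∀ z, (∀ x ∈ J, x ∈ box L m → |z x| ≤ b) → |X z| ≤ B) → ∀ᵐ z ∂P, |X z * χ z| ≤ B := by
    intro X B hB hX
    refine hzb.mono fun z hz => ?_
    by_cases h : z ∈ S
    · have : χ z = 1 := by simp [hχ, h]
      rw [this, mul_one]
      exact hX z (hz h)
    · have : χ z = 0 := by simp [hχ, h]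
      rw [this, mul_zero, abs_zero]
      exact hB
  have hK0 : 0 ≤ Kc := by rw [hKdef]; positivity
  have hYK : ∀ c, ∀ᵐ z ∂P, |Y c z * χ z| ≤ Kc := by
    intro c
    refine cut hK0 fun z hz => ?_
    fin_cases c
    · rw [show Y ⟨0, by norm_num⟩ z = psi1p s D κ a L w v m z from hY0 z]
      exact (abs_psi1p_le_box hκ hJ hA0 hA' hv hb hz).trans (by rw [hKdef]; nlinarith)
    · rw [show Y ⟨1, by norm_num⟩ z = psi1pp s D κ a L w v m z from hY1 z]
      exact (abs_psi1pp_le_box hκ hJ hA0 hA' hv hb hz).trans (le_of_eq hKdef.symm)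
    · rw [show Y ⟨2, by norm_num⟩ z = psi2 s D κ a L w m z from hY2 z]
      exact (abs_psi2_le_box hκ hJ hA0 hA' hb hz).trans (by rw [hKdef]; nlinarith)
  have h01K : ∀ᵐ z ∂P, |(Y 0 z + Y 1 z) * χ z| ≤ Kc := by
    refine cut hK0 fun z hz => ?_
    rw [hY0, hY1, psi1pp, add_sub_cancel]
    exact (abs_psi1_le_box hκ hJ hA0 hA' hv hb hz).trans (by rw [hKdef]; nlinarith)
  have h02K : ∀ᵐ z ∂P, |(Y 0 z + Y 2 z) * χ z| ≤ Kc := by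
    refine cut hK0 fun z hz => ?_
    rw [hY0, hY2]
    calc _ ≤ |psi1p s D κ a L w v m z| + |psi2 s D κ a L w m z| := abs_add_le _ _
      _ ≤ 2 * K₀ + 2 * K₀ := add_le_add (abs_psi1p_le_box hκ hJ hA0 hA' hv hb hz) (abs_psi2_le_box hκ hJ hA0 hA' hb hz)
      _ = Kc := by rw [hKdef]; ring
  have hΨK : ∀ᵐ z ∂P, |(Y 0 z + Y 1 z + Y 2 z + psi3 s D κ a L w v m z) * χ z| ≤ Kc := by
    refine cut hK0 fun z hz => ?_
    rw [hsumΨ]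
    exact (abs_psiBox_le_local hκ hJ hA0 hA' hb hz).trans (by rw [hKdef]; nlinarith)
  have hε0 : 0 ≤ ε := by
    show 0 ≤ s1Const s D d κ * A * b ^ D * Real.exp (-(κ / 4 * v)) * (L : ℝ) ^ d
    have := s1Const_nonneg hκ s D d
    positivity
  have hεK : ε ≤ Kc := by
    have h1 : Real.exp (-(κ / 4 * v)) ≤ 1 := Real.exp_le_one_iff.2 (by
      have : (0 : ℝ) ≤ κ / 4 * v := by positivity
      linarith)
    calc ε = K₀ * Real.exp (-(κ / 4 * v)) := by simp only [hK₀]; ring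
      _ ≤ K₀ * 1 := mul_le_mul_of_nonneg_left h1 hK₀0
      _ ≤ Kc := by rw [hKdef]; linarith
  have hDε : ∀ᵐ z ∂P, |psi3 s D κ a L w v m z * χ z| ≤ ε :=
    cut hε0 fun z hz => abs_psi3_le_box hκ hJ hA hv hb hz
  -- (5.19): the volume of the box event, from the Lemma-2 rows on the shrink
  have hW : Real.exp (-W) ≤ ∫ z, χ z ∂P := by
    rw [hχ, integral_indicator_one hSm]
    have hL2 := appC_lemma2_of_shift hK u hb0 I (shrink L m w) hvar hm
    have h519 : Real.exp (-(3 * (((shrink L m w).card : ℝ) * Real.exp (-(b ^ 2 / 4))))) ≤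
        P.real {z | ∀ x ∈ shrink L m w, |z x| < b * (1 + distToRegion I x)} :=
      (exp_neg_three_mul_le (by positivity) hsmall).trans (by rw [hP]; linarith)
    refine h519.trans (measureReal_mono (fun z hz x hx => (hz x (Finset.mem_coe.1 hx)).le) ?_)
    exact measure_ne_top _ _
  -- (5.29)₁ from the rows: removing χ from a colouring's joint cumulant, per colouring
  have hcχ : ∀ k : ℕ, ∀ f : Fin (k + 1) → Fin 3,
      |ursellOf (fun P' : Finset (Fin (k + 1)) => ∫ z, ∏ j ∈ P', Y (f j) z * χ z ∂P) univ -
        ursellOf (fun P' : Finset (Fin (k + 1)) => ∫ z, ∏ j ∈ P', Y (f j) z ∂P) univ| ≤ cχ (k + 1) := by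
    intro k f
    have h := abs_ursellOf_tupleSum_mul_sub_shift_le_of_rows
      (σ := Fin (k + 1)) (s := s) (D := D) (ϰ := κ) (a := a) hK u hdiag hb0 I (shrink L m w) hKu hu hvar hm hJI
      (fun j => T (f j)) (M := M) (fun j => hM (f j)) hχm hχ0 hχ1 hχE
    rw [Fintype.card_fin] at h
    exact h
  -- restate the displayed cluster inputs through the abbreviation `Y`
  have h29Y : ∀ k < t, ∀ f : Fin (k + 1) → Fin 3, (∃ j, f j = 1) → (∃ j, f j = 2) →
      |ursellOf (fun P' : Finset (Fin (k + 1)) => ∫ z, ∏ j ∈ P', Y (f j) z ∂P) univ| ≤ δ₂₉ (k + 1) := h29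
  have h31Y : ∀ k < t, ∀ f : Fin (k + 1) → Fin 3, (∃ j, f j = 1) → (∀ j, f j ≠ 2) →
      |ursellOf (fun P' : Finset (Fin (k + 1)) => ∫ z, ∏ j ∈ P', Y (f j) z ∂P) univ -
        ursellOf (fun P' : Finset (Fin (k + 1)) => ∫ z, ∏ j ∈ P', Y (f j) z ∂ν) univ| ≤ δ₃₁ (k + 1) := h31
  -- nonnegativity of the χ-removal constant
  have hM0 : 0 ≤ M := (Finset.sum_nonneg fun p _ => Finset.sum_nonneg fun Δ _ => Finset.sum_nonneg fun n _ =>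
    mul_nonneg (abs_nonneg _) (Real.exp_pos _).le).trans (hM 0)
  have hcχ0 : ∀ k, 0 ≤ cχ k := fun k => by
    have h1 : (0 : ℝ) ≤ min 1 (2 * ((shrink L m w).card : ℝ) * Real.exp (-(b ^ 2 / 4))) :=
      le_min zero_le_one (by positivity)
    have h2 : (0 : ℝ) ≤ (1 + Ku) ^ D * M * momentConst D (2 * k) c₀ := by
      have := one_le_momentConst D (2 * k) c₀
      have : (0 : ℝ) ≤ (1 + Ku) ^ D := pow_nonneg (by linarith) _
      positivity
    exact mul_nonneg (pow_nonneg (by norm_num) _) (mul_nonneg (Finset.sum_nonneg fun _ _ => Nat.cast_nonneg _)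
      (mul_nonneg (Real.rpow_nonneg h1 _) (pow_nonneg h2 _)))
  -- the generic per-box relation with the per-colouring inputs
  have hmain := Literature.MathematicalPhysics.QuantumFieldTheory.Balaban1983to89.B1Eq324BenfattoSect5PerBox.abs_log_integral_perBox_le_of_colourings
    (μ := P) (Y := Y) (D := fun z => psi3 s D κ a L w v m z) (χ := χ) (K := Kc) (ε := ε) (W := W) (t := t)
    (δ₂₉ := fun k => cχ k + δ₂₉ k) (δ₃₁ := fun k => cχ k + δ₃₁ k)
    (u₀ := fun n f => ursellOf (fun P' : Finset (Fin n) => ∫ z, ∏ j ∈ P', Y (f j) z ∂ν) univ)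
    hχm hχ0 hχ1 hYm hDm hYK h01K h02K hΨK hDε hε0 hεK hW
    (fun k => add_nonneg (hcχ0 k) (hδ₂₉ k)) (fun k => add_nonneg (hcχ0 k) (hδ₃₁ k))
    (fun k hk f h1 h2 => by
      have ha := hcχ k f
      have hb' := h29Y k hk f h1 h2
      have htri := abs_sub_abs_le_abs_sub
        (ursellOf (fun P' : Finset (Fin (k + 1)) => ∫ z, ∏ j ∈ P', Y (f j) z * χ z ∂P) univ)
        (ursellOf (fun P' : Finset (Fin (k + 1)) => ∫ z, ∏ j ∈ P', Y (f j) z ∂P) univ)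
      show _ ≤ cχ (k + 1) + δ₂₉ (k + 1)
      linarith)
    (fun k hk f h1 h2 => by
      have ha := hcχ k f
      have hb' := h31Y k hk f h1 h2
      have htri := abs_sub_le
        (ursellOf (fun P' : Finset (Fin (k + 1)) => ∫ z, ∏ j ∈ P', Y (f j) z * χ z ∂P) univ)
        (ursellOf (fun P' : Finset (Fin (k + 1)) => ∫ z, ∏ j ∈ P', Y (f j) z ∂P) univ)
        (ursellOf (fun P' : Finset (Fin (k + 1)) => ∫ z, ∏ j ∈ P', Y (f j) z ∂ν) univ)
      show _ ≤ cχ (k + 1) + δ₃₁ (k + 1)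
      linarith)
  beta_reduce at hmain
  -- back to print's integrals: `χ e^{Xχ} = 𝟙_S e^{X}`, `X = Ψ_□` resp. `Ψ′₁ + Ψ₂`
  have hset : ∀ (X X' : (B1Eq324BenfattoLemma.Site d → ℝ) → ℝ), (∀ z, X z = X' z) →
      ∫ z, χ z * Real.exp (X z * χ z) ∂P = ∫ z in S, Real.exp (X' z) ∂P := by
    intro X X' hXX'
    rw [Literature.MathematicalPhysics.QuantumFieldTheory.Balaban1983to89.B1Eq324BenfattoSect5PerBox.integral_mul_exp_mul_eq_of_indicator
      hχ01, ← integral_indicator hSm]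
    refine integral_congr_ae (ae_of_all _ fun z => ?_)
    by_cases hz : z ∈ S
    · simp [hχ, hz, hXX' z]
    · simp [hχ, hz]
  have hχm' : AEStronglyMeasurable χ P := hχm.aestronglyMeasurable
  have hposA : 0 < ∫ z, χ z * Real.exp ((Y 0 z + Y 1 z + Y 2 z + psi3 s D κ a L w v m z) * χ z) ∂P :=
    integral_mul_exp_pos hχm hχ0 hχ1 ((((((hYm 0).add (hYm 1)).add (hYm 2)).add hDm).mul hχm').aemeasurable) hΨK hW
  have hposB : 0 < ∫ z, χ z * Real.exp ((Y 0 z + Y 2 z) * χ z) ∂P :=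
    integral_mul_exp_pos hχm hχ0 hχ1 ((((hYm 0).add (hYm 2)).mul hχm').aemeasurable) h02K hW
  rw [hset (fun z => Y 0 z + Y 1 z + Y 2 z + psi3 s D κ a L w v m z) (fun z => psiBox s D κ a L w m z) hsumΨ]
    at hmain hposA
  rw [hset (fun z => Y 0 z + Y 2 z) (fun z => psi1p s D κ a L w v m z + psi2 s D κ a L w m z) hsum02] at hmain hposB
  have hlog : |Real.log lhs - Real.log rhs - E| ≤ Err := hmain
  refine ⟨hposA, hposB, hlog, ?_, ?_⟩
  · have h1 : Real.log rhs + (E - Err) ≤ Real.log lhs := by linarith [(abs_le.1 hlog).1]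
    calc Real.exp (E - Err) * rhs = Real.exp (Real.log rhs + (E - Err)) := by
          rw [Real.exp_add, Real.exp_log hposB, mul_comm]
      _ ≤ Real.exp (Real.log lhs) := Real.exp_le_exp.2 h1
      _ = lhs := Real.exp_log hposA
  · have h1 : Real.log lhs ≤ Real.log rhs + (E + Err) := by linarith [(abs_le.1 hlog).2]
    calc lhs = Real.exp (Real.log lhs) := (Real.exp_log hposA).symm
      _ ≤ Real.exp (Real.log rhs + (E + Err)) := Real.exp_le_exp.2 h1
      _ = Real.exp (E + Err) * rhs := by rw [Real.exp_add, Real.exp_log hposB, mul_comm]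

end OnData

end Literature.MathematicalPhysics.QuantumFieldTheory.Balaban1983to89.B1Eq324BenfattoKernelSect5PerBoxOnData
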